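import Literature.NumberTheory.Automorphic.Liu2021.AppendixC.HonestCorrespondencePoints
import Literature.NumberTheory.Automorphic.Liu2021.AppendixC.EichlerShimuraPointwiseAssembly
import Literature.NumberTheory.Automorphic.Liu2021.AppendixC.EichlerShimuraPointwiseTheta
import Literature.NumberTheory.Automorphic.Liu2021.AlbaneseCocycleDescent
import Literature.NumberTheory.Automorphic.Liu2021.NablaTransitive
import Literature.NumberTheory.Automorphic.Liu2021.NablaMapSurjectiveOfPieces
import Literature.AlgebraicGeometry.Motives.SpecialFibreFrobeniusPoints
import HarnessLib

/-!
# Eichler–Shimura on the special fibre, POINTWISE, from the congruence on points of the curve model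
# ([Liu2021] App. D proof of Cor. D.9 (p. 139); [DiamondShurman2005] Thm. 8.7.2)

Topic `Literature/NumberTheory/Automorphic/Liu2021/AppendixC`; namespace
`Literature.NumberTheory.Automorphic.Liu2021.AppendixC.Sec42Data.HeckeTranslates`.  PROOF FILE (theorems only; no definition, no named
fact, no instance, no `sorry`).  Cell `hodgecm-mathlib` (D-0151), FLOOR 0, programme F0P5a (D9op road 2′, crux item stmt-HodgeConjecture-24832):
THE ED. 4 COMPOSITION of `Cruxes/HLiu418/Lines/F0_D9opRoad2.lean` — the pole letter `RecordCurveEichlerShimuraPointwise` («`𝒯̄₁(ᾱ(F z)) =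
d • ᾱ(F² z) + q • 𝒯̄₂(ᾱ z)` for every geometric point `z` of `(𝒮 × 𝒮)_w`») from the six letters H (surjectivity of the reduction map of the
proper model), C1b (the Albanese trace), C3 (THE CONGRUENCE ON POINTS of the smooth model), U (`∇u` surjective on points), π0 (reduction separates
`∇`-classes), Fr (an arithmetic Frobenius reduces to `F`) — written ONCE, generically over an abstract §4.2 datum `C` with Hecke translates `T`
(F0P5a-p02 (g0) hand-back memo §2 steps 1–6; planner ED4-CUT-LETTER §8), every step a named theorem:

* L1 `z = red_{𝒮⊗𝒮}(x, y)` (H for the pair model, ★ `IntegralModel.geomReductionMap_tensor_surjective`).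
* L2 `𝒯̄(ᾱ(red(x,y))) = red_𝒜(𝒯(αd(x,y)))` (★ C2 `integralModel_geomReductionMap_map_of_μ_additive`, ★ `…_map_hom_geomPointsMap`).
* L3 off `∇`: `αd(x,y) = 1` ⇒ all three terms vanish.
* L4 on `∇`: ★ C1 `comp_nablaTr_comp_α_comp_trace_sum_albTr` at a `∇X_N`-lift — `αd(x,y) ≫ 𝒯 = ∏_δ ∏_i αd(T_{gᵢ} δ x̃, T_{gᵢ} δ ỹ)`.
* L5 reduce (★ `integralModel_geomReductionMap_prod_finsetProd`, ★ `geomReductionMap_tensor_lift`): `𝒯̄(ᾱ z) = Σ_δ Σ_i ᾱ(red T δ x̃, red T δ ỹ)`.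
* L6 per `δ`: ★ `EichlerShimuraAssembly.sum_pairing_eq_of_multiset_eq_of_rel` with the `∇`-relation (★ cocycle `Albanese.isCocycle_of_isProjectiveOver`,
  ★ `Nabla.isTransitive_of_isProjectiveOver`, π0), the two C3 multiset identities at `δ x̃`, `δ ỹ`, Frobenius twists as Galois twists (Fr).
* L7 assembly (`F`-linearity ★ `SpecialFibreFrobeniusPoints`).

HC_CM is proved only modulo the 7 printed citations until rung 0 closes; nothing of [Liu2021] D.8 is asserted here (C3 is a HYPOTHESIS).

## References
* [Liu2021] Y. Liu, *Fourier–Jacobi cycles and arithmetic relative trace formula*, Camb. J. Math. 9 (2021), App. D proof of Cor. D.9 (p. 139),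
  Def. 2.1 (1), Def. 2.3, §4.2.
* [DiamondShurman2005] F. Diamond, J. Shurman, *A First Course in Modular Forms*, Thm. 8.7.2 (p. 353).
* [SerreTate1968] J.-P. Serre, J. Tate, *Good reduction of abelian varieties*, §1.
-/

set_option autoImplicit false

noncomputable section

open CategoryTheory CategoryTheory.Limits MonoidalCategory CartesianMonoidalCategory AlgebraicGeometry NumberField
  IsDedekindDomain IsDedekindDomain.HeightOneSpectrum
open Literature.AlgebraicGeometry.Motives (SchemeOver AbelianVariety AlgPoints IntegralModel frobeniusOver specOver)
open Literature.AlgebraicGeometry.Motives.AbelianVariety (Hom.geomPointsMap Hom.geomPointsMap_id Hom.geomPointsMap_comp frobeniusHom)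
open Literature.NumberTheory.DiophantineGeometry (specialFibreFunctor geomResidueField IsAbelianSchemeModel)
open Literature.NumberTheory.EllipticCurves (genericFibre)

namespace Literature.NumberTheory.Automorphic.Liu2021.AppendixC

open scoped MonObj

/-! ### §0 `∇`-pairs of field-valued points are stable under Galois (reflexivity ★ `Nabla.exists_comp_incl_eq_lift_self`, F0P5a-p02 (g2)) -/

section NablaPoints

variable {k : Type} [Field k] {X : SchemeOver k} (N : Nabla X) {L : Type} [Field L] [Algebra k L]

/-- Galois-stability: if `(p, q)` is a point of `∇X` then so is `(σ • p, σ • q)` for `σ ∈ Aut(L/k)` (`∇X` is defined over `k`; ★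
`AlgPoints.smul_lift`, ★ `AlgPoints.map_smul`). [cite: Liu2021, Def. 2.1 (1) (FJcycle.tex l. 1171–1176)] [cite: Hartshorne1977, II Ex. 4.7] -/
theorem Nabla.exists_comp_incl_eq_lift_smul (σ : L ≃ₐ[k] L) {p q : AlgPoints X L} (h : ∃ z : AlgPoints N.N L, z ≫ N.incl = lift p q) :
    ∃ z : AlgPoints N.N L, z ≫ N.incl = lift (σ • p) (σ • q) := by
  obtain ⟨z, hz⟩ := h
  refine ⟨σ • z, ?_⟩
  rw [← AlgPoints.smul_lift, ← AlgPoints.map_apply, AlgPoints.map_smul, AlgPoints.map_apply, hz]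

end NablaPoints

variable {F E : Type} [Field F] [NumberField F] [IsTotallyReal F] [Field E] [NumberField E] [Algebra F E]
  [IsTotallyComplex E] [Algebra.IsQuadraticExtension F E]
variable {P5 : PropC5Data F E} {isotropicAt : ℕ → Prop}

namespace Sec42Data.HeckeTranslates

variable {C : Sec42Data P5 isotropicAt} (T : C.HeckeTranslates)

/-! ### §1 Upstairs: the difference `αd` on `∇`-pairs is a cocycle, and the honest correspondence on a `∇_N`-lift (L4) -/

/-- **The cocycle of `αd` on `∇`-triples of points**: `αd(p,q) · αd(q,r) = αd(p,r)` in `A_K(Ω)` whenever `(p,q)`, `(q,r)` are points of `∇X_K`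
(then so is `(p,r)`: ★ `Nabla.isTransitive_of_isProjectiveOver`), for the clopen extension `αd` of the Albanese morphism `α_K` (`incl ≫ αd = α_K`) —
the Albanese cocycle ★ `Albanese.isCocycle_of_isProjectiveOver` ([Liu2021] §2.1; `X_K` smooth projective, `E ⊂ ℂ`).
[cite: Liu2021, §2.1 Proposition with proof (FJcycle.tex l. 1190–1200) and Def. 2.3] -/
theorem map_albDiff_mul_of_nabla [Algebra E ℂ] (K : C5.SmallLevel C.S.K₀) (αd : C.X K ⊗ C.X K ⟶ (C.A K).X)
    (hαd : (C.alb K).nabla.incl ≫ αd = (C.alb K).α) {L : Type} [Field L] [Algebra E L] (p q r : AlgPoints (C.X K) L)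
    (hpq : ∃ z : AlgPoints (C.alb K).nabla.N L, z ≫ (C.alb K).nabla.incl = lift p q)
    (hqr : ∃ z : AlgPoints (C.alb K).nabla.N L, z ≫ (C.alb K).nabla.incl = lift q r) :
    AlgPoints.map αd (lift p q) * AlgPoints.map αd (lift q r) = AlgPoints.map αd (lift p r) := by
  haveI : SmoothOfRelativeDimension (C.n - 1) (C.X K).hom := C.cpt.smooth_X K
  obtain ⟨zpq, hzpq⟩ := hpq
  obtain ⟨zqr, hzqr⟩ := hqr
  obtain ⟨zpr, hzpr⟩ := Nabla.isTransitive_of_isProjectiveOver (d := C.n - 1) (C.cpt.projective_X K) (C.alb K).nabla p q r zpq zqr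
    hzpq hzqr
  have e : ∀ {a b : AlgPoints (C.X K) L} (z : AlgPoints (C.alb K).nabla.N L), z ≫ (C.alb K).nabla.incl = lift a b →
      AlgPoints.map αd (lift a b) = z ≫ (C.alb K).α := fun z hz => by
    rw [AlgPoints.map_apply, ← hz, Category.assoc, hαd]
  rw [e zpq hzpq, e zqr hzqr, e zpr hzpr]
  exact Albanese.isCocycle_of_isProjectiveOver (d := C.n - 1) (C.cpt.projective_X K) (C.alb K) p q r zpq zqr zpr hzpq hzqr hzpr

/-- **L4 — the honest correspondence at a `∇X_N`-lift, read through `αd`**: for a `W`-point `zN` of `∇X_N` with `zN ≫ incl_N = ⟨x̃, ỹ⟩`,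
`(zN ≫ ∇u ≫ incl_K) ≫ αd ≫ (t ≫ Σ_{i∈s} Alb(T_{gᵢ})) = ∏_δ ∏_{i∈s} ⟨T_{gᵢ}(δ x̃), T_{gᵢ}(δ ỹ)⟩ ≫ αd` in the group `A_K(W)` (★ C1
`comp_nablaTr_comp_α_comp_trace_sum_albTr`, ★ `Nabla.map_incl`, `incl_K ≫ αd = α_K`). [cite: Liu2021, Def. 2.3 (FJcycle.tex l. 1206–1208) and §4.2 (l. 2070–2074)]
[cite: Lang1983AbelianVarieties, Ch. VIII §6 Thm. 13 (pp. 224–227)] -/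
theorem lift_comp_albDiff_comp_trace_sum_albTr {N K : C5.SmallLevel C.S.K₀} (f : N ⟶ K)
    (αd : C.X K ⊗ C.X K ⟶ (C.A K).X) (hαd : (C.alb K).nabla.incl ≫ αd = (C.alb K).α)
    {Δ : Type} [Fintype Δ] (act : Δ → (C.cpt.X.obj N ⟶ C.cpt.X.obj N))
    (t : C.A K ⟶ C.A N) (ht : C.Atr f ≫ t = ∑ δ, (C.alb N).map (C.alb N) (act δ))
    {I : Type} (s : Finset I) (g : I → C.G) (hg : ∀ i, C5.HeckeLE (g i) N K)
    {L : Type} [Field L] [Algebra E L] (zN : AlgPoints (C.alb N).nabla.N L) (x' y' : AlgPoints (C.X N) L)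
    (hzN : zN ≫ (C.alb N).nabla.incl = lift x' y') :
    (zN ≫ C.nablaTr f ≫ (C.alb K).nabla.incl) ≫ αd ≫ (t ≫ ∑ i ∈ s, T.albTr (g i) N K (hg i)).hom.hom.hom =
      ∏ δ, ∏ i ∈ s, AlgPoints.map αd (lift (AlgPoints.map (act δ ≫ T.tr (g i) N K (hg i)) x') (AlgPoints.map (act δ ≫ T.tr (g i) N K (hg i)) y')) := by
  have e1 : (zN ≫ C.nablaTr f ≫ (C.alb K).nabla.incl) ≫ αd ≫ (t ≫ ∑ i ∈ s, T.albTr (g i) N K (hg i)).hom.hom.hom =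
      zN ≫ C.nablaTr f ≫ (C.alb K).α ≫ (t ≫ ∑ i ∈ s, T.albTr (g i) N K (hg i)).hom.hom.hom := by
    simp only [Category.assoc, reassoc_of% hαd]
  rw [e1, T.comp_nablaTr_comp_α_comp_trace_sum_albTr f act t ht s g hg zN]
  refine Finset.prod_congr rfl fun δ _ => Finset.prod_congr rfl fun i _ => ?_
  rw [← hαd, Nabla.map_incl_assoc, Nabla.map_incl_assoc, reassoc_of% hzN, lift_map_assoc, lift_map_assoc]
  simp only [AlgPoints.map_apply, Category.assoc]

/-! ### §2 Downstairs: reductions through the Néron extension (L2, L5) -/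

section Reduction

variable (w : HeightOneSpectrum (𝓞 E)) {K : C5.SmallLevel C.S.K₀}
  {𝒜 : SchemeOver (valuationSubringAtPrime E w)} [GrpObj 𝒜]

/-- **C2 on a pair of points**: `red_{⟨𝒜,e⟩}(αd(p, q)) = 𝔞_w⟨red_𝒮 p, red_𝒮 q⟩` in `𝒜_w(κ̄(w))` (★ `integralModel_geomReductionMap_map_of_μ_additive` + ★
`geomReductionMap_tensor_lift`). [cite: SerreTate1968, §1] [cite: BLRNeronModels1990, §1.2 Prop. 8] -/
theorem ofMul_geomReductionMap_map_albDiff_lift (h : IsAbelianSchemeModel (C.A K) w 𝒜)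
    (𝒮 : IntegralModel (valuationSubringAtPrime E w) E (C.X K)) [IsProper 𝒮.total.hom]
    (αd : C.X K ⊗ C.X K ⟶ (C.A K).X) (𝔞 : 𝒮.total ⊗ 𝒮.total ⟶ 𝒜)
    (h𝔞 : Functor.LaxMonoidal.μ (genericFibre (valuationSubringAtPrime E w) E) 𝒮.total 𝒮.total ≫
        (genericFibre (valuationSubringAtPrime E w) E).map 𝔞 ≫ h.exists_iso.choose.hom = (𝒮.genericIso.hom ⊗ₘ 𝒮.genericIso.hom) ≫ αd)
    (p q : AlgPoints (C.X K) (AlgebraicClosure (w.adicCompletion E))) :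
    (Additive.ofMul (haveI := h.isProper
      (⟨𝒜, h.exists_iso.choose⟩ : IntegralModel (valuationSubringAtPrime E w) E (C.A K).X).geomReductionMap (AlgPoints.map αd (lift p q))) :
        h.specialFibre.geomPoints) =
      Additive.ofMul (AlgPoints.map ((specialFibreFunctor w).map 𝔞)
        (lift (𝒮.geomReductionMap p) (𝒮.geomReductionMap q) ≫ Functor.LaxMonoidal.μ (specialFibreFunctor w) 𝒮.total 𝒮.total)) := by
  rw [h.integralModel_geomReductionMap_map_of_μ_additive 𝒮 𝒮 αd 𝔞 h𝔞 (lift p q), IntegralModel.geomReductionMap_tensor_lift]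

/-- **L2 — `𝒯̃(𝔞_w(red_{𝒮⊗𝒮} P)) = red_{⟨𝒜,e⟩}(𝒯(αd P))`**: the reduction `𝒯̃` of a homomorphism `𝒯 : A_K → A_K` applied to `𝔞_w` of the reduction
of a point `P` of `X_K × X_K` is the reduction of `𝒯(αd(P))` (★ C2 `integralModel_geomReductionMap_map_of_μ_additive`, ★
`integralModel_geomReductionMap_map_hom_geomPointsMap`). [cite: SerreTate1968, §1] [cite: Shimura1998, §11.1 Prop. 12] -/
theorem geomPointsMap_specialFibreHom_ofMul_map_geomReductionMap_tensor (h : IsAbelianSchemeModel (C.A K) w 𝒜)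
    (𝒮 : IntegralModel (valuationSubringAtPrime E w) E (C.X K)) [IsProper 𝒮.total.hom]
    (αd : C.X K ⊗ C.X K ⟶ (C.A K).X) (𝔞 : 𝒮.total ⊗ 𝒮.total ⟶ 𝒜)
    (h𝔞 : Functor.LaxMonoidal.μ (genericFibre (valuationSubringAtPrime E w) E) 𝒮.total 𝒮.total ≫
        (genericFibre (valuationSubringAtPrime E w) E).map 𝔞 ≫ h.exists_iso.choose.hom = (𝒮.genericIso.hom ⊗ₘ 𝒮.genericIso.hom) ≫ αd)
    (𝒯 : C.A K ⟶ C.A K) (P : AlgPoints (C.X K ⊗ C.X K) (AlgebraicClosure (w.adicCompletion E))) :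
    Hom.geomPointsMap (h.specialFibreHom h 𝒯) (Additive.ofMul (AlgPoints.map ((specialFibreFunctor w).map 𝔞)
        (haveI := IntegralModel.isProper_tensor_total 𝒮 𝒮; (𝒮.tensor 𝒮).geomReductionMap P))) =
      (Additive.ofMul (haveI := h.isProper
        (⟨𝒜, h.exists_iso.choose⟩ : IntegralModel (valuationSubringAtPrime E w) E (C.A K).X).geomReductionMap
          (AlgPoints.map 𝒯.hom.hom.hom (AlgPoints.map αd P))) : h.specialFibre.geomPoints) := by
  erw [← h.integralModel_geomReductionMap_map_of_μ_additive 𝒮 𝒮 αd 𝔞 h𝔞 P]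
  exact (h.integralModel_geomReductionMap_map_hom_geomPointsMap h 𝒯 (AlgPoints.map αd P)).symm

/-- **L5 — reduction of the product of L4**: `red_{⟨𝒜,e⟩}(∏_δ ∏_{i∈s} αd(P δ i, Q δ i)) = Σ_δ Σ_{i∈s} 𝔞_w⟨red P δ i, red Q δ i⟩` (★
`integralModel_geomReductionMap_prod_finsetProd` + C2 on pairs). [cite: SerreTate1968, §1] [cite: BLRNeronModels1990, §1.2 Prop. 8] -/
theorem ofMul_geomReductionMap_prod_map_albDiff_lift (h : IsAbelianSchemeModel (C.A K) w 𝒜)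
    (𝒮 : IntegralModel (valuationSubringAtPrime E w) E (C.X K)) [IsProper 𝒮.total.hom]
    (αd : C.X K ⊗ C.X K ⟶ (C.A K).X) (𝔞 : 𝒮.total ⊗ 𝒮.total ⟶ 𝒜)
    (h𝔞 : Functor.LaxMonoidal.μ (genericFibre (valuationSubringAtPrime E w) E) 𝒮.total 𝒮.total ≫
        (genericFibre (valuationSubringAtPrime E w) E).map 𝔞 ≫ h.exists_iso.choose.hom = (𝒮.genericIso.hom ⊗ₘ 𝒮.genericIso.hom) ≫ αd)
    {Δ I : Type} [Fintype Δ] (s : Finset I) (P Q : Δ → I → AlgPoints (C.X K) (AlgebraicClosure (w.adicCompletion E))) :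
    (Additive.ofMul (haveI := h.isProper
      (⟨𝒜, h.exists_iso.choose⟩ : IntegralModel (valuationSubringAtPrime E w) E (C.A K).X).geomReductionMap
        (∏ δ, ∏ i ∈ s, AlgPoints.map αd (lift (P δ i) (Q δ i)))) : h.specialFibre.geomPoints) =
      ∑ δ, ∑ i ∈ s, (Additive.ofMul (AlgPoints.map ((specialFibreFunctor w).map 𝔞)
        (lift (𝒮.geomReductionMap (P δ i)) (𝒮.geomReductionMap (Q δ i)) ≫ Functor.LaxMonoidal.μ (specialFibreFunctor w) 𝒮.total 𝒮.total)) :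
          h.specialFibre.geomPoints) := by
  rw [h.integralModel_geomReductionMap_prod_finsetProd]
  refine Finset.sum_congr rfl fun δ _ => Finset.sum_congr rfl fun i _ => ?_
  exact ofMul_geomReductionMap_map_albDiff_lift w h 𝒮 αd 𝔞 h𝔞 (P δ i) (Q δ i)

end Reduction

/-! ### §3 The composition -/

/-- **Eichler–Shimura on the special fibre, pointwise, from the congruence on points** ([Liu2021] App. D proof of Cor. D.9, p. 139;
[DiamondShurman2005] Thm. 8.7.2) — the ed. 4 composition `stub_C ⇐ H + C1b + C3 + U + π0 + Fr` of `F0_D9opRoad2`, generic over a §4.2 datum `C`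
with Hecke translates `T`.  DATA at levels `N ⊆ K` (`f`), a finite place `w` of `E`: an abelian-scheme model `𝒜` of `A_K` (`h`), a PROPER integral model
`𝒮` of `X_K`, the clopen extension `αd` of `α_K` (`hαd`; `hαd1`: `αd = 1` off `∇X_K`), its Néron extension `𝔞 : 𝒮 ⊗ 𝒮 ⟶ 𝒜` (`h𝔞`), deck
automorphisms `act δ` over `u = X.map f` (`hact`) with an Albanese trace `t` (`ht`), finite families of translates `T_{g₁ i}`, `T_{g₂ j}` defined at
`N → K`, and an integer `q`.  HYPOTHESES (the letters): H `hH` (the reduction map of `𝒮` is onto), U `hU` (`∇u` onto on `Ω`-points), π0 `hπ0` (equal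
reductions ⇒ a `∇X_K`-pair), Fr `σ, hσ` (`red(σ • x) = F(red x)`), C3 `hC3` (the congruence on points: `Σ_i {F red T_{g₁ i} x} = {F F red (u x)} +
Σ_j q • {red T_{g₂ j} x}` for every `x ∈ X_N(Ω)`).  CONCLUSION, for every geometric point `z` of `(𝒮 ⊗ 𝒮)_w`:
`𝒯̄₁(𝔞_w(F z)) = |Δ| • 𝔞_w(F (F z)) + q • 𝒯̄₂(𝔞_w z)` in `𝒜_w(κ̄(w))`, `𝒯ᵢ := t ≫ Σ Alb(T_{gᵢ ·})`, `𝒯̄ᵢ` its reduction (★ `specialFibreHom`).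
[cite: Liu2021, App. D proof of Cor. D.9 (FJcycle.tex l. 5586–5600; print p. 139)] [cite: DiamondShurman2005, Thm. 8.7.2 (p. 353)] -/
theorem eichlerShimura_pointwise_of_congruence [Algebra E ℂ] (w : HeightOneSpectrum (𝓞 E)) {N K : C5.SmallLevel C.S.K₀} (f : N ⟶ K)
    {𝒜 : SchemeOver (valuationSubringAtPrime E w)} [GrpObj 𝒜] (h : IsAbelianSchemeModel (C.A K) w 𝒜)
    (𝒮 : IntegralModel (valuationSubringAtPrime E w) E (C.X K)) [IsProper 𝒮.total.hom]
    (αd : C.X K ⊗ C.X K ⟶ (C.A K).X) (hαd : (C.alb K).nabla.incl ≫ αd = (C.alb K).α)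
    (hαd1 : ∀ {W : SchemeOver E} (P : W ⟶ C.X K ⊗ C.X K), Set.range ⇑P.left ⊆ (Set.range ⇑(C.alb K).nabla.incl.left)ᶜ → P ≫ αd = 1)
    (𝔞 : 𝒮.total ⊗ 𝒮.total ⟶ 𝒜)
    (h𝔞 : Functor.LaxMonoidal.μ (genericFibre (valuationSubringAtPrime E w) E) 𝒮.total 𝒮.total ≫
        (genericFibre (valuationSubringAtPrime E w) E).map 𝔞 ≫ h.exists_iso.choose.hom = (𝒮.genericIso.hom ⊗ₘ 𝒮.genericIso.hom) ≫ αd)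
    {Δ : Type} [Fintype Δ] (act : Δ → (C.cpt.X.obj N ⟶ C.cpt.X.obj N)) (hact : ∀ δ, act δ ≫ C.cpt.X.map f = C.cpt.X.map f)
    (t : C.A K ⟶ C.A N) (ht : C.Atr f ≫ t = ∑ δ, (C.alb N).map (C.alb N) (act δ))
    {I J : Type} [Fintype I] [Fintype J] (g₁ : I → C.G) (hg₁ : ∀ i, C5.HeckeLE (g₁ i) N K) (g₂ : J → C.G) (hg₂ : ∀ j, C5.HeckeLE (g₂ j) N K)
    (q : ℕ)
    (hH : Function.Surjective 𝒮.geomReductionMap)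
    (hU : Function.Surjective (AlgPoints.map (L := AlgebraicClosure (w.adicCompletion E)) (C.nablaTr f)))
    (hπ0 : ∀ p p' : AlgPoints (C.X K) (AlgebraicClosure (w.adicCompletion E)), 𝒮.geomReductionMap p = 𝒮.geomReductionMap p' →
      ∃ z : AlgPoints (C.alb K).nabla.N (AlgebraicClosure (w.adicCompletion E)), z ≫ (C.alb K).nabla.incl = lift p p')
    (σ : Field.absoluteGaloisGroup (w.adicCompletion E))
    (hσ : ∀ x : AlgPoints (C.X K) (AlgebraicClosure (w.adicCompletion E)),
      𝒮.geomReductionMap (σ • x) = AlgPoints.map (frobeniusOver 𝒮.reductionAt) (𝒮.geomReductionMap x))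
    (hC3 : ∀ x : AlgPoints (C.X N) (AlgebraicClosure (w.adicCompletion E)),
      ∑ i, ({AlgPoints.map (frobeniusOver 𝒮.reductionAt) (𝒮.geomReductionMap (AlgPoints.map (T.tr (g₁ i) N K (hg₁ i)) x))} :
          Multiset (AlgPoints 𝒮.reductionAt (geomResidueField w))) =
        {AlgPoints.map (frobeniusOver 𝒮.reductionAt) (AlgPoints.map (frobeniusOver 𝒮.reductionAt)
            (𝒮.geomReductionMap (AlgPoints.map (C.cpt.X.map f) x)))} +
          ∑ j, q • ({𝒮.geomReductionMap (AlgPoints.map (T.tr (g₂ j) N K (hg₂ j)) x)} : Multiset (AlgPoints 𝒮.reductionAt (geomResidueField w))))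
    (z : AlgPoints ((specialFibreFunctor w).obj (𝒮.total ⊗ 𝒮.total)) (geomResidueField w)) :
    Hom.geomPointsMap (h.specialFibreHom h (t ≫ ∑ i, T.albTr (g₁ i) N K (hg₁ i)))
        (Additive.ofMul (AlgPoints.map ((specialFibreFunctor w).map 𝔞) (AlgPoints.map (frobeniusOver _) z))) =
      (Fintype.card Δ : ℤ) • Hom.geomPointsMap (𝟙 h.specialFibre)
          (Additive.ofMul (AlgPoints.map ((specialFibreFunctor w).map 𝔞)
            (AlgPoints.map (frobeniusOver _) (AlgPoints.map (frobeniusOver _) z)))) +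
        (q : ℤ) • Hom.geomPointsMap (h.specialFibreHom h (t ≫ ∑ j, T.albTr (g₂ j) N K (hg₂ j)))
          (Additive.ofMul (AlgPoints.map ((specialFibreFunctor w).map 𝔞) z)) := by
  classical
  haveI := IntegralModel.isProper_tensor_total 𝒮 𝒮
  haveI hOI : IsOpenImmersion (C.alb K).nabla.incl.left := (C.alb K).nabla.isOpenImmersion_incl
  -- Step 1 (H for the pair model): `z = red_{𝒮⊗𝒮} P`, and `P = ⟨x, y⟩`
  obtain ⟨P, rfl⟩ := IntegralModel.geomReductionMap_tensor_surjective 𝒮 𝒮 hH hH z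
  rw [← lift_comp_fst_snd P]
  generalize P ≫ fst _ _ = x
  generalize P ≫ snd _ _ = y
  clear P
  -- the downstairs difference `AR a b := 𝔞_w⟨a, b⟩ ∈ 𝒜_w(κ̄(w))` and its `F`-linearity (★ `SpecialFibreFrobeniusPoints`)
  set AR : AlgPoints 𝒮.reductionAt (geomResidueField w) → AlgPoints 𝒮.reductionAt (geomResidueField w) → h.specialFibre.geomPoints :=
    fun a b => Additive.ofMul (AlgPoints.map ((specialFibreFunctor w).map 𝔞)
      (lift a b ≫ Functor.LaxMonoidal.μ (specialFibreFunctor w) 𝒮.total 𝒮.total)) with hAR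
  have hπAR : ∀ a b : AlgPoints 𝒮.reductionAt (geomResidueField w),
      Hom.geomPointsMap (frobeniusHom h.specialFibre) (AR a b) =
        AR (AlgPoints.map (frobeniusOver 𝒮.reductionAt) a) (AlgPoints.map (frobeniusOver 𝒮.reductionAt) b) := fun a b => by
    have e1 := IsAbelianSchemeModel.ofMul_map_specialFibreFunctor_map_frobeniusOver h 𝔞
      (lift a b ≫ Functor.LaxMonoidal.μ (specialFibreFunctor w) 𝒮.total 𝒮.total)
    have e2 : AlgPoints.map (frobeniusOver ((specialFibreFunctor w).obj (𝒮.total ⊗ 𝒮.total)))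
        (lift a b ≫ Functor.LaxMonoidal.μ (specialFibreFunctor w) 𝒮.total 𝒮.total) =
        lift (AlgPoints.map (frobeniusOver 𝒮.reductionAt) a) (AlgPoints.map (frobeniusOver 𝒮.reductionAt) b) ≫
          Functor.LaxMonoidal.μ (specialFibreFunctor w) 𝒮.total 𝒮.total :=
      IntegralModel.map_frobeniusOver_lift_comp_μ_specialFibreFunctor 𝒮.total 𝒮.total a b
    rw [e2] at e1
    exact e1.symm
  -- `ᾱ(red_{𝒮⊗𝒮}⟨p, q⟩) = AR (red p) (red q)`
  have hV : ∀ p p' : AlgPoints (C.X K) (AlgebraicClosure (w.adicCompletion E)),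
      (Additive.ofMul (AlgPoints.map ((specialFibreFunctor w).map 𝔞) ((𝒮.tensor 𝒮).geomReductionMap (lift p p'))) :
        h.specialFibre.geomPoints) = AR (𝒮.geomReductionMap p) (𝒮.geomReductionMap p') := fun p p' => by
    rw [IntegralModel.geomReductionMap_tensor_lift]
  -- Step 2 (`F`-linearity): LHS `= π(𝒯̄₁(ᾱ z))`, middle `= π(π(ᾱ z))`
  rw [IsAbelianSchemeModel.geomPointsMap_specialFibreHom_ofMul_map_frobeniusOver h h (t ≫ ∑ i, T.albTr (g₁ i) N K (hg₁ i)) 𝔞,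
    IsAbelianSchemeModel.ofMul_map_specialFibreFunctor_map_frobeniusOver_frobeniusOver h 𝔞, Hom.geomPointsMap_id,
    AddMonoidHom.id_apply]
  -- L2 for both honest correspondences
  have hL2 := fun (𝒯 : C.A K ⟶ C.A K) (P : AlgPoints (C.X K ⊗ C.X K) (AlgebraicClosure (w.adicCompletion E))) =>
    geomPointsMap_specialFibreHom_ofMul_map_geomReductionMap_tensor w h 𝒮 αd 𝔞 h𝔞 𝒯 P
  by_cases hxy : ∃ zK : AlgPoints (C.alb K).nabla.N (AlgebraicClosure (w.adicCompletion E)), zK ≫ (C.alb K).nabla.incl = lift x y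
  swap
  · -- Step 3 (CASE off `∇X_K`): `αd⟨x, y⟩ = 1`, so all three terms vanish
    have h1 : AlgPoints.map αd (lift x y) = 1 := by
      rw [AlgPoints.map_apply]
      refine hαd1 _ ?_
      rintro _ ⟨pt, rfl⟩ hmem
      apply hxy
      obtain rfl : pt = IsLocalRing.closedPoint (AlgebraicClosure (w.adicCompletion E)) :=
        Subsingleton.elim (α := ↥(Spec (CommRingCat.of (AlgebraicClosure (w.adicCompletion E))))) _ _
      exact AlgPoints.exists_comp_eq_of_pt_mem_range _ _ hmem
    have hV1 : ∀ 𝒯 : C.A K ⟶ C.A K, Hom.geomPointsMap (h.specialFibreHom h 𝒯)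
        (Additive.ofMul (AlgPoints.map ((specialFibreFunctor w).map 𝔞) ((𝒮.tensor 𝒮).geomReductionMap (lift x y)))) = 0 := fun 𝒯 => by
      rw [hL2 𝒯, h1, AlgPoints.map_apply, MonObj.one_comp]
      exact h.integralModel_geomReductionMap_one
    have hV0 : AR (𝒮.geomReductionMap x) (𝒮.geomReductionMap y) = 0 := by
      have e := hV1 (𝟙 (C.A K))
      rw [h.specialFibreHom_id, Hom.geomPointsMap_id, AddMonoidHom.id_apply, hV x y] at e
      exact e
    rw [hV1 (t ≫ ∑ i, T.albTr (g₁ i) N K (hg₁ i)), hV1 (t ≫ ∑ j, T.albTr (g₂ j) N K (hg₂ j)), hV x y, hV0, map_zero, map_zero,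
      smul_zero, smul_zero, add_zero]
  -- Step 4 (CASE on `∇X_K`): lift `⟨x, y⟩` to `∇X_N` (U)
  obtain ⟨zK, hzK⟩ := hxy
  obtain ⟨zN, hzN⟩ := hU zK
  set x' : AlgPoints (C.X N) (AlgebraicClosure (w.adicCompletion E)) := AlgPoints.map ((C.alb N).nabla.incl ≫ fst _ _) zN with hx'
  set y' : AlgPoints (C.X N) (AlgebraicClosure (w.adicCompletion E)) := AlgPoints.map ((C.alb N).nabla.incl ≫ snd _ _) zN with hy'
  have hlift : lift x y = zN ≫ C.nablaTr f ≫ (C.alb K).nabla.incl := by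
    rw [← hzK, ← hzN, AlgPoints.map_apply, Category.assoc]
  -- `σ ∈ Γ_{E_w}` acts through `Aut(Ω/E)`
  set τ : AlgebraicClosure (w.adicCompletion E) ≃ₐ[E] AlgebraicClosure (w.adicCompletion E) :=
    AlgEquiv.restrictScalars E (Field.absoluteGaloisGroup.toAlgEquiv (w.adicCompletion E) σ) with hτ
  have hστ : ∀ {Y : SchemeOver E} (P : AlgPoints Y (AlgebraicClosure (w.adicCompletion E))), σ • P = τ • P := fun P => rfl
  -- L4 + L5 at a general `∇X_N`-lift: `𝒯̄(ᾱ(red⟨xx, yy⟩)) = Σ_δ Σ_i AR(red T δ x̃, red T δ ỹ)`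
  have hL45 : ∀ (xx yy : AlgPoints (C.X K) (AlgebraicClosure (w.adicCompletion E)))
      (zz : AlgPoints (C.alb N).nabla.N (AlgebraicClosure (w.adicCompletion E)))
      (hzz : lift xx yy = zz ≫ C.nablaTr f ≫ (C.alb K).nabla.incl)
      {I' : Type} [Fintype I'] (g' : I' → C.G) (hg' : ∀ i, C5.HeckeLE (g' i) N K),
      Hom.geomPointsMap (h.specialFibreHom h (t ≫ ∑ i, T.albTr (g' i) N K (hg' i)))
        (Additive.ofMul (AlgPoints.map ((specialFibreFunctor w).map 𝔞) ((𝒮.tensor 𝒮).geomReductionMap (lift xx yy)))) =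
      ∑ δ, ∑ i, AR (𝒮.geomReductionMap (AlgPoints.map (act δ ≫ T.tr (g' i) N K (hg' i))
          (AlgPoints.map ((C.alb N).nabla.incl ≫ fst _ _) zz)))
        (𝒮.geomReductionMap (AlgPoints.map (act δ ≫ T.tr (g' i) N K (hg' i)) (AlgPoints.map ((C.alb N).nabla.incl ≫ snd _ _) zz))) := by
    intro xx yy zz hzz I' _ g' hg'
    have hzz' : zz ≫ (C.alb N).nabla.incl = lift (AlgPoints.map ((C.alb N).nabla.incl ≫ fst _ _) zz)
        (AlgPoints.map ((C.alb N).nabla.incl ≫ snd _ _) zz) := by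
      rw [AlgPoints.map_apply, AlgPoints.map_apply, ← Category.assoc, ← Category.assoc, lift_comp_fst_snd]
    rw [hL2, AlgPoints.map_apply, AlgPoints.map_apply, Category.assoc, hzz,
      T.lift_comp_albDiff_comp_trace_sum_albTr f αd hαd act t ht Finset.univ g' hg' zz _ _ hzz',
      ofMul_geomReductionMap_prod_map_albDiff_lift w h 𝒮 αd 𝔞 h𝔞 Finset.univ]
    rfl
  -- `x̃ ↦ x` under `u` (and the deck transformations)
  have hxu : ∀ δ, AlgPoints.map (act δ ≫ C.cpt.X.map f) x' = x := fun δ => by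
    have e := congrArg (· ≫ fst _ _) hlift
    rw [lift_fst, C.nablaTr_incl, Category.assoc, Category.assoc, tensorHom_fst] at e
    rw [hact, e, hx', AlgPoints.map_apply, AlgPoints.map_apply, Category.assoc, Category.assoc]
  have hyu : ∀ δ, AlgPoints.map (act δ ≫ C.cpt.X.map f) y' = y := fun δ => by
    have e := congrArg (· ≫ snd _ _) hlift
    rw [lift_snd, C.nablaTr_incl, Category.assoc, Category.assoc, tensorHom_snd] at e
    rw [hact, e, hy', AlgPoints.map_apply, AlgPoints.map_apply, Category.assoc, Category.assoc]
  -- `∇X_K`-pairs among the derived points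
  have hrel : ∀ φ : C.X N ⟶ C.X K, ∃ z : AlgPoints (C.alb K).nabla.N (AlgebraicClosure (w.adicCompletion E)),
      z ≫ (C.alb K).nabla.incl = lift (AlgPoints.map φ x') (AlgPoints.map φ y') := fun φ =>
    ⟨zN ≫ (C.alb N).nabla.map (C.alb K).nabla φ, by
      rw [Category.assoc, Nabla.map_incl, hx', hy', AlgPoints.map_apply, AlgPoints.map_apply, AlgPoints.map_apply,
        AlgPoints.map_apply, ← lift_map, ← Category.assoc zN (C.alb N).nabla.incl (fst _ _),
        ← Category.assoc zN (C.alb N).nabla.incl (snd _ _), lift_comp_fst_snd, Category.assoc]⟩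
  have hrelxy : ∃ z : AlgPoints (C.alb K).nabla.N (AlgebraicClosure (w.adicCompletion E)),
      z ≫ (C.alb K).nabla.incl = lift (σ • σ • x) (σ • σ • y) := by
    rw [hστ, hστ, hστ, hστ]
    exact Nabla.exists_comp_incl_eq_lift_smul _ τ (Nabla.exists_comp_incl_eq_lift_smul _ τ ⟨zK, hzK⟩)
  have hliftσ : lift (σ • x) (σ • y) = (σ • zN) ≫ C.nablaTr f ≫ (C.alb K).nabla.incl := by
    rw [hστ, hστ, hστ, ← AlgPoints.smul_lift, hlift, AlgPoints.smul_def, AlgPoints.smul_def, Category.assoc]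
  -- the last term through L4 + L5 at the lift `zN`
  rw [hL45 x y zN hlift g₂ hg₂]
  -- the left-hand side: `π(𝒯̄₁(ᾱ⟨red x, red y⟩)) = 𝒯̄₁(ᾱ⟨red σx, red σy⟩)`, then L4 + L5 at the lift `σ • zN`
  rw [← IsAbelianSchemeModel.geomPointsMap_specialFibreHom_geomPointsMap_frobeniusHom h h, hV, hπAR, hπAR]
  rw [← hσ, ← hσ, ← hV (σ • x) (σ • y), hL45 (σ • x) (σ • y) (σ • zN) hliftσ g₁ hg₁]
  simp only [hστ, AlgPoints.map_smul]
  simp only [← hστ, hσ, ← hx', ← hy']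
  -- bookkeeping of the scalars
  have hM : ∀ m : h.specialFibre.geomPoints, ((Fintype.card Δ : ℕ) : ℤ) • m = ∑ _δ : Δ, m := fun m => by
    rw [Finset.sum_const, Finset.card_univ, natCast_zsmul]
  rw [hM, Finset.smul_sum, ← Finset.sum_add_distrib]
  refine Finset.sum_congr rfl fun δ _ => ?_
  -- Step 6 (Bk3 per deck transformation `δ`): ★ `sum_pairing_eq_of_multiset_eq_of_rel`
  haveI : SmoothOfRelativeDimension (C.n - 1) (C.X K).hom := C.cpt.smooth_X K
  have ha := hC3 (AlgPoints.map (act δ) x')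
  have hb := hC3 (AlgPoints.map (act δ) y')
  simp only [← AlgPoints.map_comp_apply, hxu, hyu, ← hσ] at ha hb
  have hA := EichlerShimuraAssembly.sum_pairing_eq_of_multiset_eq_of_rel (G := h.specialFibre.geomPoints)
    𝒮.geomReductionMap hH
    (fun p p' => ∃ z : AlgPoints (C.alb K).nabla.N (AlgebraicClosure (w.adicCompletion E)), z ≫ (C.alb K).nabla.incl = lift p p')
    (fun p => Nabla.exists_comp_incl_eq_lift_self _ p)
    (fun p p' ⟨z, hz⟩ => (C.alb K).nabla.exists_swap p p' z hz)
    (fun p p' p'' ⟨z, hz⟩ ⟨z', hz'⟩ =>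
      Nabla.isTransitive_of_isProjectiveOver (d := C.n - 1) (C.cpt.projective_X K) _ p p' p'' z z' hz hz')
    hπ0
    (fun p p' => (Additive.ofMul (haveI := h.isProper
      (⟨𝒜, h.exists_iso.choose⟩ : IntegralModel (valuationSubringAtPrime E w) E (C.A K).X).geomReductionMap
        (AlgPoints.map αd (lift p p'))) : h.specialFibre.geomPoints))
    (fun p p' p'' hpp' hp'p'' => by
      have e := h.integralModel_geomReductionMap_mul (AlgPoints.map αd (lift p p')) (AlgPoints.map αd (lift p' p''))
      rw [map_albDiff_mul_of_nabla K αd hαd p p' p'' hpp' hp'p''] at e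
      exact e.symm)
    AR (fun p p' _ => (ofMul_geomReductionMap_map_albDiff_lift w h 𝒮 αd 𝔞 h𝔞 p p').symm)
    Finset.univ Finset.univ
    (fun i => σ • AlgPoints.map (act δ ≫ T.tr (g₁ i) N K (hg₁ i)) x') (fun i => σ • AlgPoints.map (act δ ≫ T.tr (g₁ i) N K (hg₁ i)) y')
    (fun i _ => by
      simp only [hστ]
      exact Nabla.exists_comp_incl_eq_lift_smul _ τ (hrel _))
    (σ • σ • x) (σ • σ • y) hrelxy
    (fun j => AlgPoints.map (act δ ≫ T.tr (g₂ j) N K (hg₂ j)) x') (fun j => AlgPoints.map (act δ ≫ T.tr (g₂ j) N K (hg₂ j)) y')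
    (fun j _ => hrel _) q ha hb
  simp only [hσ, ← natCast_zsmul] at hA
  exact hA

end Sec42Data.HeckeTranslates

end Literature.NumberTheory.Automorphic.Liu2021.AppendixC

end
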